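import Summits.HodgeConjecture.HodgeConjecture.Theorems.Ring2WeilCoverageRamifiedTypes
import HarnessLib

/-!
# Weil-type family coverage — THE NORM-SIGN LAW for polarisation types: multiplying a type `𝔣₀` by a principal
# ideal `(ϖ₀)` of `K⁺` PRESERVES the verdict «`ℂ^Φ/D(𝔪)` carries a `Φ`-positive divisor of that type» iff
# `N_{K⁺/ℚ}(ϖ₀) > 0` and FLIPS it iff `N_{K⁺/ℚ}(ϖ₀) < 0` (any CM field `K`, any CM type `Φ`, any lattice `𝔪`, any
# type `𝔣₀`; no residue dictionary)

research route conditional on HC_CM; not a corollary; Q11.4-sentence-2 already refuted in dim ≥ 3.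

Ring 2, WEIL-TYPE FAMILY-COVERAGE CENSUS (`HOME/WEIL-FAMILY-COVERAGE.md` `## b01`, blocks b01.41 (ramified and
quadratic-surd polarisation types on the nine NO rows, each with its own residue sign dictionary `A_π`, and the
observed FLIP LAW «a prime `𝔮 = (ϖ)` of `ℚ(ζ_M)⁺` flips the verdict iff `N_{ℚ(ζ_M)⁺/ℚ}(ϖ) < 0`»), b01.34–b01.40;
owner ring2-b01), part 55 of the `Ring2WeilCoverage*` series.  Parts 48/53 (`…RamifiedTypes`, `…RealGeneratorTypes`)
decided ONE generator `ϖ` at a time, through a residue dictionary `Re σ_t(ϖ) < 0 ↔ t ∈ A` that had to be supplied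
level by level (Gauss sums for the surds, the `negAt` law for `ζ^h(1 − ζ^a)(1 − ζ^b)`).  This file removes the
dictionary: the only invariant of a real `ϖ₀ ∈ K⁺ˣ` that matters is the SIGN OF ITS NORM.

Setting of part 2 (`…CMUnitSignature`): `K` ANY CM field (`IsCMField K`, `ρ = complexConj K`, `K⁺ =
maximalRealSubfield K`), `Φ` any CM type, `𝔪` any lattice (invertible fractional ideal), `𝔣₀ ⊆ 𝓞 K⁺` any type,
`ζ₀ ≠ 0` a skew element with `IsOfType 𝔪 ζ₀ 𝔣₀` (`𝔬𝔣₀ = ζ₀𝔡𝔪𝔪^ρ`, Shimura §14.3), `ϖ₀ ∈ 𝓞 K⁺ ∖ 0` with image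
`ϖ ∈ K`.

* §0 `card_filter_not_iff_add_two_mul`: `|{¬(P ↔ Q)}| + 2|{P ∧ Q}| = |{P}| + |{Q}|` on a finset (the parity of a
  symmetric difference).
* §1 `complexConj_realMul`, `isOfType_realMul`: `ϖζ₀` is skew and **`IsOfType 𝔪 (ϖζ₀) ((ϖ₀)·𝔣₀)`** — multiplying
  the skew element by a real integer multiplies the type by the principal ideal it generates.
* §2 `ncard_negSet_realMul_mod_two`: `#{φ ∈ Φ : Im (ϖζ₀)^φ < 0} ≡ #{φ ∈ Φ : Re ϖ^φ < 0} + #{φ ∈ Φ : Im ζ₀^φ < 0}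
  (mod 2)` (`Im (ϖζ₀)^φ = Re ϖ^φ · Im ζ₀^φ`, part 2: the negative set of `ϖζ₀` is a symmetric difference).
* §3 **`norm_pos_iff_even_ncard` / `norm_neg_iff_odd_ncard`**: `N_{K⁺/ℚ}(ϖ₀) > 0 ⟺ #{φ ∈ Φ : Re ϖ^φ < 0}` even —
  for EVERY CM type `Φ` (part 2's `∏_{φ∈Φ} Re ϖ^φ = N_{K⁺/ℚ}(ϖ₀)`: a CM type restricts bijectively to the real
  places of `K⁺`).
* §4 **`even_ncard_negSet_realMul_iff`** (hypothesis-free): `#{Im (ϖζ₀)^φ < 0}` even ⟺ (`#{Im ζ₀^φ < 0}` even ⟺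
  `N(ϖ₀) > 0`).
* §5 THE LAW under the census's two class-field inputs THEOREM L (i) (`hN`: every unit of `𝓞 K⁺` has positive
  norm) and THEOREM L (ii) on `Φ` (`hU'`: every even sign pattern on `Φ` is the pattern of a real unit):
  `exists_pos_isOfType_iff_even` (part 2 packaged: type `𝔣₀` occurs ⟺ `#{Im ζ₀^φ < 0}` even),
  **`exists_pos_isOfType_realMul_iff`: «type `(ϖ₀)𝔣₀` occurs on `ℂ^Φ/D(𝔪)`» ⟺ («type `𝔣₀` occurs» ⟺ `N(ϖ₀) > 0`)**,
  `…_iff_of_norm_pos` (same verdict), `…_iff_not_of_norm_neg` (opposite verdict), and the one-hypothesis halves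
  `not_and_of_norm_neg` (`hN` alone: never both) / `or_of_norm_neg` (`hU'` alone: at least one).

Sequel (part 55b, `…TypeNormSignPrincipal`): the principal reference `𝔣₀ = 𝔬₀` («type `(ϖ₀)` occurs ⟺ (principal ⟺
`N(ϖ₀) > 0`)») and the cyclotomic torus `ℂ^Φ/Φ(ℤ[ζₙ])` with the reference `ξ_k = ζ^k/Φₙ′(ζ)`; the level files (parts
56–) then read «type `(ϖ₀)` occurs ⟺ `N(ϖ₀) < 0`» on every NO row and «⟺ `N(ϖ₀) > 0`» on every YES row, for ALL real
generators at once.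

HONEST FRAMING: torus-level statements about Shimura's divisors `X_ζ` of type `(K; Φ; 𝔣₀)` [Sh98 §14.3 Prop. 4–5]
and the norm of an element of `K⁺`; the component / hermitian discriminant of the polarised point is NOT computed
here; nothing in this file is a statement about Hodge classes, `W_K`, general members or HC; `HC_CM` is used
nowhere.  No `def`, no named fact, no `sorry`.

References: [cite: Shimura1998, §14.3 Prop. 4–5, pp. 103–104]; [cite: Shimura1998, §14.2 Prop. 2, p. 102]; census
b01.41 (B)/(B′) «flip ⟺ `N_{K⁺/ℚ}(ϖ) < 0`» (seat-derived).
-/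

noncomputable section

open scoped Classical nonZeroDivisors NumberField ComplexConjugate
open NumberField NumberField.ComplexEmbedding Module FractionalIdeal Complex Polynomial

namespace Summit.HodgeConjecture.Ring2WeilCoverage.TypeNormSign

open Literature.AlgebraicGeometry.Motives (CMType)
open Literature.NumberTheory.ComplexMultiplication
open Literature.NumberTheory.ComplexMultiplication.CMTypeLattice
open Summit.HodgeConjecture.Ring2WeilCoverage.CMTypeSignParity
open Summit.HodgeConjecture.Ring2WeilCoverage.CMUnitSignature

/-! ### §0 The parity of a symmetric difference -/

/-- **`|{i : ¬(P i ↔ Q i)}| + 2·|{i : P i ∧ Q i}| = |{i : P i}| + |{i : Q i}|`** on a finset — so the count of an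
«exclusive or» has the parity of the sum of the two counts.
research route conditional on HC_CM; not a corollary; Q11.4-sentence-2 already refuted in dim ≥ 3. [folklore] -/
theorem card_filter_not_iff_add_two_mul {ι : Type*} (s : Finset ι) (P Q : ι → Prop) [DecidablePred P]
    [DecidablePred Q] :
    (s.filter fun i => ¬ (P i ↔ Q i)).card + 2 * (s.filter fun i => P i ∧ Q i).card =
      (s.filter P).card + (s.filter Q).card := by
  induction s using Finset.induction_on with
  | empty => simp
  | insert a s ha ih =>
    simp only [Finset.filter_insert]
    by_cases hP : P a <;> by_cases hQ : Q a <;>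
      simp only [hP, hQ, iff_true, iff_false, not_true_eq_false, not_false_eq_true, and_true, and_false,
        ite_true, ite_false, Finset.card_insert_of_notMem (fun h => ha (Finset.mem_of_mem_filter a h))]
        <;> omega

/-- Parity form: `|{i : ¬(P i ↔ Q i)}| ≡ |{i : P i}| + |{i : Q i}| (mod 2)`.
research route conditional on HC_CM; not a corollary; Q11.4-sentence-2 already refuted in dim ≥ 3. [folklore] -/
theorem card_filter_not_iff_mod_two {ι : Type*} (s : Finset ι) (P Q : ι → Prop) [DecidablePred P]
    [DecidablePred Q] :
    (s.filter fun i => ¬ (P i ↔ Q i)).card % 2 = ((s.filter P).card + (s.filter Q).card) % 2 := by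
  have h := card_filter_not_iff_add_two_mul s P Q
  omega

/-- For non-zero reals `a, b`: `a·b < 0 ⟺ ¬(a < 0 ↔ b < 0)` (exactly one factor is negative).
research route conditional on HC_CM; not a corollary; Q11.4-sentence-2 already refuted in dim ≥ 3. [folklore] -/
theorem mul_neg_iff_not_iff {a b : ℝ} (ha : a ≠ 0) (hb : b ≠ 0) : a * b < 0 ↔ ¬ (a < 0 ↔ b < 0) := by
  rcases lt_or_gt_of_ne ha with ha' | ha' <;> rcases lt_or_gt_of_ne hb with hb' | hb'
  · exact ⟨fun h => absurd (mul_pos_of_neg_of_neg ha' hb') (lt_asymm h), fun h => absurd ⟨fun _ => hb', fun _ => ha'⟩ h⟩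
  · exact ⟨fun _ h => (lt_asymm hb') (h.mp ha'), fun _ => mul_neg_of_neg_of_pos ha' hb'⟩
  · exact ⟨fun _ h => (lt_asymm ha') (h.mpr hb'), fun _ => mul_neg_of_pos_of_neg ha' hb'⟩
  · exact ⟨fun h => absurd (mul_pos ha' hb') (lt_asymm h), fun h => absurd ⟨fun h' => absurd h' (lt_asymm ha'),
      fun h' => absurd h' (lt_asymm hb')⟩ h⟩

section General

variable {K : Type} [Field K] [NumberField K] [IsCMField K] (Φ : CMType K)
  (𝔪 : (FractionalIdeal (𝓞 K)⁰ K)ˣ) {ζ₀ : K} {𝔣₀ : Ideal (𝓞 (maximalRealSubfield K))}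

/-- the image in `K` of an integer `ϖ₀` of the maximal real subfield. -/
local notation3 (prettyPrint := false) "𝓇 " x:max => (algebraMap (𝓞 (maximalRealSubfield K)) K x)

/-! ### §1 Multiplying the skew element by a real integer multiplies the type by the ideal it generates -/

/-- `𝓇 ϖ₀` is real: `(𝓇 ϖ₀)^ρ = 𝓇 ϖ₀`. [folklore] -/
theorem complexConj_algebraMap_ringOfIntegers (ϖ₀ : 𝓞 (maximalRealSubfield K)) :
    IsCMField.complexConj K (𝓇 ϖ₀) = 𝓇 ϖ₀ := by
  rw [IsScalarTower.algebraMap_apply (𝓞 (maximalRealSubfield K)) (maximalRealSubfield K) K]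
  exact IsCMField.complexConj_apply_eq_self K _

omit [NumberField K] [IsCMField K] in
/-- `𝓇 ϖ₀ ≠ 0` for `ϖ₀ ≠ 0`. [folklore] -/
theorem algebraMap_ringOfIntegers_ne_zero {ϖ₀ : 𝓞 (maximalRealSubfield K)} (h0 : ϖ₀ ≠ 0) : 𝓇 ϖ₀ ≠ 0 := by
  rw [IsScalarTower.algebraMap_apply (𝓞 (maximalRealSubfield K)) (maximalRealSubfield K) K]
  intro h
  apply h0
  have h1 : ((ϖ₀ : maximalRealSubfield K) : K) = 0 := h
  have h2 : (ϖ₀ : maximalRealSubfield K) = 0 := by exact_mod_cast h1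
  exact_mod_cast h2

/-- **`ϖζ₀` is skew** for real `ϖ = 𝓇 ϖ₀` and skew `ζ₀`.
research route conditional on HC_CM; not a corollary; Q11.4-sentence-2 already refuted in dim ≥ 3. [folklore] -/
theorem complexConj_realMul (ϖ₀ : 𝓞 (maximalRealSubfield K)) (hζ₀ : IsCMField.complexConj K ζ₀ = -ζ₀) :
    IsCMField.complexConj K (𝓇 ϖ₀ * ζ₀) = -(𝓇 ϖ₀ * ζ₀) := by
  rw [map_mul, complexConj_algebraMap_ringOfIntegers, hζ₀, mul_neg]

/-- **`IsOfType 𝔪 (ϖζ₀) ((ϖ₀)·𝔣₀)`**: if `X_{ζ₀}` on `ℂ^Φ/D(𝔪)` has type `𝔣₀` (`𝔬𝔣₀ = ζ₀𝔡𝔪𝔪^ρ`) then `X_{ϖζ₀}` has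
type `(ϖ₀)𝔣₀` (`𝔬(ϖ₀)𝔣₀ = (ϖζ₀)𝔡𝔪𝔪^ρ`) — Shimura's types form a torsor under the principal ideals of `K⁺`.
research route conditional on HC_CM; not a corollary; Q11.4-sentence-2 already refuted in dim ≥ 3. [cite: Shimura1998, §14.3 Prop. 4–5, pp. 103–104] -/
theorem isOfType_realMul (ϖ₀ : 𝓞 (maximalRealSubfield K)) (hT : IsOfType 𝔪 ζ₀ 𝔣₀) :
    IsOfType 𝔪 (𝓇 ϖ₀ * ζ₀) (Ideal.span {ϖ₀} * 𝔣₀) := by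
  rw [isOfType_iff] at hT ⊢
  rw [Ideal.map_mul, Ideal.map_span, Set.image_singleton, FractionalIdeal.coeIdeal_mul,
    FractionalIdeal.coeIdeal_span_singleton, hT, ← FractionalIdeal.spanSingleton_mul_spanSingleton,
    IsScalarTower.algebraMap_apply (𝓞 (maximalRealSubfield K)) (𝓞 K) K]
  simp only [mul_assoc]

/-! ### §2 The negative set of `ϖζ₀` is the symmetric difference of those of `ϖ` and `ζ₀` -/

/-- `Im (ϖζ₀)^φ < 0 ⟺ ¬(Re ϖ^φ < 0 ↔ Im ζ₀^φ < 0)` for real `ϖ ≠ 0`, skew `ζ₀ ≠ 0`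
(`Im (ϖζ₀)^φ = Re ϖ^φ · Im ζ₀^φ`, part 2, both factors non-zero).
research route conditional on HC_CM; not a corollary; Q11.4-sentence-2 already refuted in dim ≥ 3. [cite: Shimura1998, §14.2 Prop. 2, p. 102] -/
theorem im_realMul_neg_iff {ϖ : K} (hϖ : IsCMField.complexConj K ϖ = ϖ) (hϖ0 : ϖ ≠ 0)
    (hζ₀ : IsCMField.complexConj K ζ₀ = -ζ₀) (h0 : ζ₀ ≠ 0) (φ : K →+* ℂ) :
    (φ (ϖ * ζ₀)).im < 0 ↔ ¬ ((φ ϖ).re < 0 ↔ (φ ζ₀).im < 0) := by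
  rw [im_embedding_mul_of_real hϖ ζ₀ φ]
  exact mul_neg_iff_not_iff (re_embedding_ne_zero_of_real hϖ hϖ0 φ) (im_embedding_ne_zero_of_skew hζ₀ h0 φ)

/-- **`#{φ ∈ Φ : Im (ϖζ₀)^φ < 0} ≡ #{φ ∈ Φ : Re ϖ^φ < 0} + #{φ ∈ Φ : Im ζ₀^φ < 0} (mod 2)`** for real `ϖ ≠ 0` and
skew `ζ₀ ≠ 0`: the negative set of `ϖζ₀` inside `Φ` is the symmetric difference of the negative sets of `ϖ` and `ζ₀`.
research route conditional on HC_CM; not a corollary; Q11.4-sentence-2 already refuted in dim ≥ 3. [folklore] -/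
theorem ncard_negSet_realMul_mod_two {ϖ : K} (hϖ : IsCMField.complexConj K ϖ = ϖ) (hϖ0 : ϖ ≠ 0)
    (hζ₀ : IsCMField.complexConj K ζ₀ = -ζ₀) (h0 : ζ₀ ≠ 0) :
    (Φ.1 ∩ {ψ : K →+* ℂ | (ψ (ϖ * ζ₀)).im < 0}).ncard % 2 =
      ((Φ.1 ∩ {ψ : K →+* ℂ | (ψ ϖ).re < 0}).ncard + (Φ.1 ∩ {ψ : K →+* ℂ | (ψ ζ₀).im < 0}).ncard) % 2 := by
  rw [← card_filter_subtype_eq_ncard Φ (fun ψ => (ψ (ϖ * ζ₀)).im < 0),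
    ← card_filter_subtype_eq_ncard Φ (fun ψ => (ψ ϖ).re < 0),
    ← card_filter_subtype_eq_ncard Φ (fun ψ => (ψ ζ₀).im < 0)]
  have h := card_filter_not_iff_mod_two (Finset.univ : Finset Φ.1) (fun φ => (φ.1 ϖ).re < 0)
    (fun φ => (φ.1 ζ₀).im < 0)
  have hc : (Finset.univ.filter fun φ : Φ.1 => (φ.1 (ϖ * ζ₀)).im < 0) =
      Finset.univ.filter fun φ : Φ.1 => ¬ ((φ.1 ϖ).re < 0 ↔ (φ.1 ζ₀).im < 0) := by
    apply Finset.filter_congr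
    intro φ _
    exact im_realMul_neg_iff hϖ hϖ0 hζ₀ h0 φ.1
  rw [hc]
  exact h

/-! ### §3 The sign of `N_{K⁺/ℚ}(ϖ₀)` is the parity of `#{φ ∈ Φ : Re ϖ^φ < 0}` — for every CM type `Φ` -/

/-- **`N_{K⁺/ℚ}(ϖ₀) > 0 ⟺ #{φ ∈ Φ : Re ϖ^φ < 0}` is EVEN**, for EVERY CM type `Φ` of `K` (part 2: `∏_{φ∈Φ} Re ϖ^φ =
N_{K⁺/ℚ}(ϖ₀)`, the restriction `Φ → Hom(K⁺, ℝ)` being a bijection).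
research route conditional on HC_CM; not a corollary; Q11.4-sentence-2 already refuted in dim ≥ 3. [folklore] -/
theorem norm_pos_iff_even_ncard {ϖ₀ : 𝓞 (maximalRealSubfield K)} (h0 : ϖ₀ ≠ 0) :
    0 < Algebra.norm ℚ ((ϖ₀ : maximalRealSubfield K)) ↔
      Even ((Φ.1 ∩ {ψ : K →+* ℂ | (ψ (𝓇 ϖ₀)).re < 0}).ncard) := by
  rw [← prod_re_pos_iff_even (complexConj_algebraMap_ringOfIntegers ϖ₀) (algebraMap_ringOfIntegers_ne_zero h0) Φ,
    IsScalarTower.algebraMap_apply (𝓞 (maximalRealSubfield K)) (maximalRealSubfield K) K,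
    prod_re_embedding_algebraMap_eq_norm Φ]
  exact_mod_cast Iff.rfl

/-- **`N_{K⁺/ℚ}(ϖ₀) < 0 ⟺ #{φ ∈ Φ : Re ϖ^φ < 0}` is ODD** (`ϖ₀ ≠ 0`, so the norm is non-zero).
research route conditional on HC_CM; not a corollary; Q11.4-sentence-2 already refuted in dim ≥ 3. [folklore] -/
theorem norm_neg_iff_odd_ncard {ϖ₀ : 𝓞 (maximalRealSubfield K)} (h0 : ϖ₀ ≠ 0) :
    Algebra.norm ℚ ((ϖ₀ : maximalRealSubfield K)) < 0 ↔
      Odd ((Φ.1 ∩ {ψ : K →+* ℂ | (ψ (𝓇 ϖ₀)).re < 0}).ncard) := by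
  have hne : Algebra.norm ℚ ((ϖ₀ : maximalRealSubfield K)) ≠ 0 := by
    rw [Algebra.norm_ne_zero_iff]
    intro h
    apply h0
    exact_mod_cast h
  rw [← Nat.not_even_iff_odd, ← norm_pos_iff_even_ncard Φ h0, not_lt]
  exact ⟨fun h => h.le, fun h => lt_of_le_of_ne h hne⟩

/-! ### §4 The parity law (hypothesis-free) -/

/-- **`#{φ ∈ Φ : Im (ϖζ₀)^φ < 0}` is even ⟺ (`#{φ ∈ Φ : Im ζ₀^φ < 0}` is even ⟺ `N_{K⁺/ℚ}(ϖ₀) > 0`)** — the negative set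
of `ϖζ₀` is that of `ζ₀` twisted by the negative places of `ϖ`, whose number has the parity of the sign of
`N(ϖ₀)`.  No hypothesis on units.
research route conditional on HC_CM; not a corollary; Q11.4-sentence-2 already refuted in dim ≥ 3. [folklore] -/
theorem even_ncard_negSet_realMul_iff {ϖ₀ : 𝓞 (maximalRealSubfield K)} (hϖ0 : ϖ₀ ≠ 0)
    (hζ₀ : IsCMField.complexConj K ζ₀ = -ζ₀) (h0 : ζ₀ ≠ 0) :
    Even ((Φ.1 ∩ {ψ : K →+* ℂ | (ψ (𝓇 ϖ₀ * ζ₀)).im < 0}).ncard) ↔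
      (Even ((Φ.1 ∩ {ψ : K →+* ℂ | (ψ ζ₀).im < 0}).ncard) ↔
        0 < Algebra.norm ℚ ((ϖ₀ : maximalRealSubfield K))) := by
  rw [norm_pos_iff_even_ncard Φ hϖ0, Nat.even_iff, Nat.even_iff, Nat.even_iff,
    ncard_negSet_realMul_mod_two Φ (complexConj_algebraMap_ringOfIntegers ϖ₀)
      (algebraMap_ringOfIntegers_ne_zero hϖ0) hζ₀ h0]
  omega

/-! ### §5 The law under THEOREM L (i) and THEOREM L (ii) -/

/-- **Type `𝔣₀` occurs ⟺ `#{φ ∈ Φ : Im ζ₀^φ < 0}` even** (part 2 packaged): under THEOREM L (i) (`hN`: every unit of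
`𝓞 K⁺` has positive norm) and THEOREM L (ii) on `Φ` (`hU'`: every even sign pattern on `Φ` is the pattern of a real
unit), for a skew `ζ₀ ≠ 0` with `IsOfType 𝔪 ζ₀ 𝔣₀`.
research route conditional on HC_CM; not a corollary; Q11.4-sentence-2 already refuted in dim ≥ 3. [cite: Shimura1998, §14.3 Prop. 5, p. 104] -/
theorem exists_pos_isOfType_iff_even (hζ₀ : IsCMField.complexConj K ζ₀ = -ζ₀) (h0 : ζ₀ ≠ 0)
    (hT : IsOfType 𝔪 ζ₀ 𝔣₀)
    (hN : ∀ v : (𝓞 (maximalRealSubfield K))ˣ,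
      0 < Algebra.norm ℚ (((v : 𝓞 (maximalRealSubfield K)) : maximalRealSubfield K)))
    (hU' : ∀ S : Set (K →+* ℂ), S ⊆ Φ.1 → Even S.ncard →
      ∃ u : (𝓞 K)ˣ, IsCMField.complexConj K ((u : 𝓞 K) : K) = ((u : 𝓞 K) : K) ∧
        ∀ φ ∈ Φ.1, ((φ ((u : 𝓞 K) : K)).re < 0 ↔ φ ∈ S)) :
    (∃ ζ : K, IsCMField.complexConj K ζ = -ζ ∧ (∀ φ : Φ.1, 0 < (φ.1 ζ).im) ∧ IsOfType 𝔪 ζ 𝔣₀) ↔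
      Even ((Φ.1 ∩ {ψ : K →+* ℂ | (ψ ζ₀).im < 0}).ncard) := by
  refine ⟨fun h => ?_, exists_pos_isOfType_of_even Φ 𝔪 hζ₀ h0 hT hU'⟩
  by_contra hne
  exact not_exists_pos_isOfType_of_norm_pos_of_odd Φ 𝔪 hζ₀ h0 hT hN (Nat.not_even_iff_odd.mp hne) h

/-- **THE NORM-SIGN LAW.**  Under THEOREM L (i)/(ii): **`ℂ^Φ/D(𝔪)` carries a `Φ`-positive divisor of type `(ϖ₀)𝔣₀`
iff (it carries one of type `𝔣₀` ⟺ `N_{K⁺/ℚ}(ϖ₀) > 0`)** — multiplying the type by `(ϖ₀)` preserves the verdict when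
`N(ϖ₀) > 0` and flips it when `N(ϖ₀) < 0`.  (`ζ₀ ≠ 0` is any skew element of type `𝔣₀` on `D(𝔪)`, positivity NOT
asked; the census's flip law of b01.41 for all generators at once.)
research route conditional on HC_CM; not a corollary; Q11.4-sentence-2 already refuted in dim ≥ 3. [cite: Shimura1998, §14.3 Prop. 4–5, pp. 103–104] -/
theorem exists_pos_isOfType_realMul_iff (hζ₀ : IsCMField.complexConj K ζ₀ = -ζ₀) (h0 : ζ₀ ≠ 0)
    (hT : IsOfType 𝔪 ζ₀ 𝔣₀) {ϖ₀ : 𝓞 (maximalRealSubfield K)} (hϖ0 : ϖ₀ ≠ 0)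
    (hN : ∀ v : (𝓞 (maximalRealSubfield K))ˣ,
      0 < Algebra.norm ℚ (((v : 𝓞 (maximalRealSubfield K)) : maximalRealSubfield K)))
    (hU' : ∀ S : Set (K →+* ℂ), S ⊆ Φ.1 → Even S.ncard →
      ∃ u : (𝓞 K)ˣ, IsCMField.complexConj K ((u : 𝓞 K) : K) = ((u : 𝓞 K) : K) ∧
        ∀ φ ∈ Φ.1, ((φ ((u : 𝓞 K) : K)).re < 0 ↔ φ ∈ S)) :
    (∃ ζ : K, IsCMField.complexConj K ζ = -ζ ∧ (∀ φ : Φ.1, 0 < (φ.1 ζ).im) ∧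
        IsOfType 𝔪 ζ (Ideal.span {ϖ₀} * 𝔣₀)) ↔
      ((∃ ζ : K, IsCMField.complexConj K ζ = -ζ ∧ (∀ φ : Φ.1, 0 < (φ.1 ζ).im) ∧ IsOfType 𝔪 ζ 𝔣₀) ↔
        0 < Algebra.norm ℚ ((ϖ₀ : maximalRealSubfield K))) := by
  rw [exists_pos_isOfType_iff_even Φ 𝔪 (complexConj_realMul ϖ₀ hζ₀)
      (mul_ne_zero (algebraMap_ringOfIntegers_ne_zero hϖ0) h0) (isOfType_realMul 𝔪 ϖ₀ hT) hN hU',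
    exists_pos_isOfType_iff_even Φ 𝔪 hζ₀ h0 hT hN hU']
  exact even_ncard_negSet_realMul_iff Φ hϖ0 hζ₀ h0

/-- **Positive norm ⇒ same verdict** for the types `𝔣₀` and `(ϖ₀)𝔣₀`.
research route conditional on HC_CM; not a corollary; Q11.4-sentence-2 already refuted in dim ≥ 3. [cite: Shimura1998, §14.3 Prop. 4–5, pp. 103–104] -/
theorem exists_pos_isOfType_realMul_iff_of_norm_pos (hζ₀ : IsCMField.complexConj K ζ₀ = -ζ₀) (h0 : ζ₀ ≠ 0)
    (hT : IsOfType 𝔪 ζ₀ 𝔣₀) {ϖ₀ : 𝓞 (maximalRealSubfield K)}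
    (hpos : 0 < Algebra.norm ℚ ((ϖ₀ : maximalRealSubfield K)))
    (hN : ∀ v : (𝓞 (maximalRealSubfield K))ˣ,
      0 < Algebra.norm ℚ (((v : 𝓞 (maximalRealSubfield K)) : maximalRealSubfield K)))
    (hU' : ∀ S : Set (K →+* ℂ), S ⊆ Φ.1 → Even S.ncard →
      ∃ u : (𝓞 K)ˣ, IsCMField.complexConj K ((u : 𝓞 K) : K) = ((u : 𝓞 K) : K) ∧
        ∀ φ ∈ Φ.1, ((φ ((u : 𝓞 K) : K)).re < 0 ↔ φ ∈ S)) :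
    (∃ ζ : K, IsCMField.complexConj K ζ = -ζ ∧ (∀ φ : Φ.1, 0 < (φ.1 ζ).im) ∧
        IsOfType 𝔪 ζ (Ideal.span {ϖ₀} * 𝔣₀)) ↔
      (∃ ζ : K, IsCMField.complexConj K ζ = -ζ ∧ (∀ φ : Φ.1, 0 < (φ.1 ζ).im) ∧ IsOfType 𝔪 ζ 𝔣₀) := by
  have hϖ0 : ϖ₀ ≠ 0 := by
    rintro rfl
    simp at hpos
  rw [exists_pos_isOfType_realMul_iff Φ 𝔪 hζ₀ h0 hT hϖ0 hN hU']
  exact ⟨fun h => h.mpr hpos, fun h => ⟨fun _ => hpos, fun _ => h⟩⟩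

/-- **Negative norm ⇒ opposite verdicts**: under THEOREM L (i)/(ii), if `N_{K⁺/ℚ}(ϖ₀) < 0` then type `(ϖ₀)𝔣₀` occurs
on `ℂ^Φ/D(𝔪)` iff type `𝔣₀` does NOT.
research route conditional on HC_CM; not a corollary; Q11.4-sentence-2 already refuted in dim ≥ 3. [cite: Shimura1998, §14.3 Prop. 4–5, pp. 103–104] -/
theorem exists_pos_isOfType_realMul_iff_not_of_norm_neg (hζ₀ : IsCMField.complexConj K ζ₀ = -ζ₀) (h0 : ζ₀ ≠ 0)
    (hT : IsOfType 𝔪 ζ₀ 𝔣₀) {ϖ₀ : 𝓞 (maximalRealSubfield K)}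
    (hneg : Algebra.norm ℚ ((ϖ₀ : maximalRealSubfield K)) < 0)
    (hN : ∀ v : (𝓞 (maximalRealSubfield K))ˣ,
      0 < Algebra.norm ℚ (((v : 𝓞 (maximalRealSubfield K)) : maximalRealSubfield K)))
    (hU' : ∀ S : Set (K →+* ℂ), S ⊆ Φ.1 → Even S.ncard →
      ∃ u : (𝓞 K)ˣ, IsCMField.complexConj K ((u : 𝓞 K) : K) = ((u : 𝓞 K) : K) ∧
        ∀ φ ∈ Φ.1, ((φ ((u : 𝓞 K) : K)).re < 0 ↔ φ ∈ S)) :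
    (∃ ζ : K, IsCMField.complexConj K ζ = -ζ ∧ (∀ φ : Φ.1, 0 < (φ.1 ζ).im) ∧
        IsOfType 𝔪 ζ (Ideal.span {ϖ₀} * 𝔣₀)) ↔
      ¬ (∃ ζ : K, IsCMField.complexConj K ζ = -ζ ∧ (∀ φ : Φ.1, 0 < (φ.1 ζ).im) ∧ IsOfType 𝔪 ζ 𝔣₀) := by
  have hϖ0 : ϖ₀ ≠ 0 := by
    rintro rfl
    simp at hneg
  rw [exists_pos_isOfType_realMul_iff Φ 𝔪 hζ₀ h0 hT hϖ0 hN hU']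
  have hnot : ¬ 0 < Algebra.norm ℚ ((ϖ₀ : maximalRealSubfield K)) := fun h => (lt_asymm h) hneg
  exact ⟨fun h h' => hnot (h.mp h'), fun h => ⟨fun h' => absurd h' h, fun h' => absurd h' hnot⟩⟩

/-- **THEOREM L (i) alone ⇒ never both**: if every unit of `𝓞 K⁺` has positive norm and `N_{K⁺/ℚ}(ϖ₀) < 0`, the
types `𝔣₀` and `(ϖ₀)𝔣₀` do not BOTH occur on `ℂ^Φ/D(𝔪)` (an occurring type has an even negative count, and the two
counts differ by an odd number).
research route conditional on HC_CM; not a corollary; Q11.4-sentence-2 already refuted in dim ≥ 3. [cite: Shimura1998, §14.3 Prop. 5, p. 104] -/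
theorem not_and_of_norm_neg (hζ₀ : IsCMField.complexConj K ζ₀ = -ζ₀) (h0 : ζ₀ ≠ 0)
    (hT : IsOfType 𝔪 ζ₀ 𝔣₀) {ϖ₀ : 𝓞 (maximalRealSubfield K)}
    (hneg : Algebra.norm ℚ ((ϖ₀ : maximalRealSubfield K)) < 0)
    (hN : ∀ v : (𝓞 (maximalRealSubfield K))ˣ,
      0 < Algebra.norm ℚ (((v : 𝓞 (maximalRealSubfield K)) : maximalRealSubfield K))) :
    ¬ ((∃ ζ : K, IsCMField.complexConj K ζ = -ζ ∧ (∀ φ : Φ.1, 0 < (φ.1 ζ).im) ∧ IsOfType 𝔪 ζ 𝔣₀) ∧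
        (∃ ζ : K, IsCMField.complexConj K ζ = -ζ ∧ (∀ φ : Φ.1, 0 < (φ.1 ζ).im) ∧
          IsOfType 𝔪 ζ (Ideal.span {ϖ₀} * 𝔣₀))) := by
  have hϖ0 : ϖ₀ ≠ 0 := by
    rintro rfl
    simp at hneg
  rintro ⟨h1, h2⟩
  have e1 : Even ((Φ.1 ∩ {ψ : K →+* ℂ | (ψ ζ₀).im < 0}).ncard) := by
    by_contra hne
    exact not_exists_pos_isOfType_of_norm_pos_of_odd Φ 𝔪 hζ₀ h0 hT hN (Nat.not_even_iff_odd.mp hne) h1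
  have e2 : Even ((Φ.1 ∩ {ψ : K →+* ℂ | (ψ (𝓇 ϖ₀ * ζ₀)).im < 0}).ncard) := by
    by_contra hne
    exact not_exists_pos_isOfType_of_norm_pos_of_odd Φ 𝔪 (complexConj_realMul ϖ₀ hζ₀)
      (mul_ne_zero (algebraMap_ringOfIntegers_ne_zero hϖ0) h0) (isOfType_realMul 𝔪 ϖ₀ hT) hN
      (Nat.not_even_iff_odd.mp hne) h2
  have h := (even_ncard_negSet_realMul_iff Φ hϖ0 hζ₀ h0).mp e2
  exact (lt_asymm (h.mp e1)) hneg

/-- **THEOREM L (ii) alone ⇒ at least one**: if every even sign pattern on `Φ` is the pattern of a real unit and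
`N_{K⁺/ℚ}(ϖ₀) < 0`, then `ℂ^Φ/D(𝔪)` carries a `Φ`-positive divisor of type `𝔣₀` OR one of type `(ϖ₀)𝔣₀` (one of the
two negative counts is even).
research route conditional on HC_CM; not a corollary; Q11.4-sentence-2 already refuted in dim ≥ 3. [cite: Shimura1998, §14.3 Prop. 5, p. 104] -/
theorem or_of_norm_neg (hζ₀ : IsCMField.complexConj K ζ₀ = -ζ₀) (h0 : ζ₀ ≠ 0)
    (hT : IsOfType 𝔪 ζ₀ 𝔣₀) {ϖ₀ : 𝓞 (maximalRealSubfield K)}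
    (hneg : Algebra.norm ℚ ((ϖ₀ : maximalRealSubfield K)) < 0)
    (hU' : ∀ S : Set (K →+* ℂ), S ⊆ Φ.1 → Even S.ncard →
      ∃ u : (𝓞 K)ˣ, IsCMField.complexConj K ((u : 𝓞 K) : K) = ((u : 𝓞 K) : K) ∧
        ∀ φ ∈ Φ.1, ((φ ((u : 𝓞 K) : K)).re < 0 ↔ φ ∈ S)) :
    (∃ ζ : K, IsCMField.complexConj K ζ = -ζ ∧ (∀ φ : Φ.1, 0 < (φ.1 ζ).im) ∧ IsOfType 𝔪 ζ 𝔣₀) ∨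
      (∃ ζ : K, IsCMField.complexConj K ζ = -ζ ∧ (∀ φ : Φ.1, 0 < (φ.1 ζ).im) ∧
        IsOfType 𝔪 ζ (Ideal.span {ϖ₀} * 𝔣₀)) := by
  have hϖ0 : ϖ₀ ≠ 0 := by
    rintro rfl
    simp at hneg
  by_cases he : Even ((Φ.1 ∩ {ψ : K →+* ℂ | (ψ ζ₀).im < 0}).ncard)
  · exact Or.inl (exists_pos_isOfType_of_even Φ 𝔪 hζ₀ h0 hT hU' he)
  · refine Or.inr (exists_pos_isOfType_of_even Φ 𝔪 (complexConj_realMul ϖ₀ hζ₀)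
      (mul_ne_zero (algebraMap_ringOfIntegers_ne_zero hϖ0) h0) (isOfType_realMul 𝔪 ϖ₀ hT) hU' ?_)
    rw [even_ncard_negSet_realMul_iff Φ hϖ0 hζ₀ h0]
    exact ⟨fun h => absurd h he, fun h => absurd hneg (lt_asymm h)⟩

end General

end Summit.HodgeConjecture.Ring2WeilCoverage.TypeNormSign

end
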